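import Summits.CriticalPhenomena.PercolationContinuityZ3.Theses.PercPorousCritical
import Summits.CriticalPhenomena.PercolationContinuityZ3.Theorems.PercNearOneGluingNoHeavyLowerTailCSHTheoremOne
import HarnessLib

/-!
# `PercPorousCritical.PorosityFromQBGN` (stmt-CriticalPhenomena-4819) — SETTLED after continuity

Item `stmt-CriticalPhenomena-4819` of route `CriticalPhenomena/PercPorousCritical` (crux/support).

The item is a statement about the counterfactual 'jump world': one of its hypotheses is `0 < θ(p_c(ℤ³))`, which contradicts the tree theorem `θ(p_c(ℤ³)) = 0` (`CSH.percolationContinuityZ3_holds`, p205010); so the implication holds vacuously.  No percolation estimate is claimed here beyond p205010.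

builds on p205010 (kernel theorem, internal audit signed; external expert review pending) — USED (`CSH.percolationContinuityZ3_holds`).  RSW3 lane, lead gen 28 (prover-prim-rsw3-lead-g28-0):
'after continuity — the ledger harvest'.
References: G. Kozma, N. Nitzan (2024), Thm. 6 / Conj. 3 [KozmaNitzan2024]; G. Grimmett, *Percolation* (1999), §8 [GrimmettPercolation1999].
-/

noncomputable section

namespace Summit.CriticalPhenomena.PercolationContinuityZ3.Theorems

namespace PercPorousCriticalPorosityFromQBGN

open MeasureTheory Literature.Probability.Percolation Literature.Probability.LatticeModels

/-- **`PercPorousCritical.PorosityFromQBGN` (stmt-CriticalPhenomena-4819), settled.**  Its hypothesis `0 < θ(p_c(ℤ³))` contradicts the tree theorem `θ(p_c(ℤ³)) = 0` (`CSH.percolationContinuityZ3_holds`, p205010): vacuous.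
[cite: KozmaNitzan2024, Thm. 6 with Conj. 3 (p. 15)] -/
theorem porosityFromQBGN_proof : Summit.CriticalPhenomena.PercolationContinuityZ3.Theses.PercPorousCritical.PorosityFromQBGN := by
  unfold Summit.CriticalPhenomena.PercolationContinuityZ3.Theses.PercPorousCritical.PorosityFromQBGN
  intros
  have h0 : theta (zdGraph 3) (0 : Site 3) (criticalProbI 3) = 0 := CSH.percolationContinuityZ3_holds
  exact absurd h0 (ne_of_gt ‹0 < theta (zdGraph 3) (0 : Site 3) (criticalProbI 3)›)

end PercPorousCriticalPorosityFromQBGN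

end Summit.CriticalPhenomena.PercolationContinuityZ3.Theorems

end
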